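import Literature.MathematicalPhysics.QuantumFieldTheory.Balaban1983to89.Node00.TorusCoverLandau153Print
import Literature.MathematicalPhysics.QuantumFieldTheory.Balaban1983to89.Node00.TorusCoverGaugeTokensRPrint

/-!
# NODE 00 — THE (152) STEP WITH ALL FOUR LETTERS AND THE (153)-GAUGE OF THE LIFT ON EVERY GRID CUBE OF A CLASS MEMBER, AT PRINT'S CUBES:
# FILE P3's `gauge152R10P_of_prop6` (⟸ [6] Proposition 6 ON PRINT'S CLASS `zdCubP`) re-run through `exists_localGauge152_153_cube_of_prop6P`

Cell `pub-ymgap`, width seat `pub-ymgap-dag-n07-w3` generation 0 (HUMAN RULING D-0149 ∕ director-ym №197; DAG node N07 = [15]; cell INBOX INTENT-4 of 2026-08-28, file (B)).  NEW leaf,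
PROOF kind (no `def`); CONSUMED BY NAME, nothing modified: this seat's `Node00.TorusCoverLandau153Print` (`exists_localGauge152_153_cube_of_prop6P`) and
`Node00.TorusCoverGaugeTokens152153` (the `propCube` edition, for comparison only), dag-n07-e's FILE P3 `Node00.TorusCoverGaugeTokensRPrint` (`b9OfP`, `a0OfP`, `a0OfP_pos`,
`b9OfP_pos`; its proof shape VERBATIM) and FILE P1 (`propCubeP`, `cubeIdxP'`, `sideP`, `sideP_le`, `le_sideP`, `cover_image_Ω_cubeIdxP'_subset`, `cover_image_Ω_cubeIdxP'_one_subset_hullD`,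
`boxWidth_propCubeP`, `propCubeP_M ∕ _k`), k0-s2-w2's `prop6Printed_zdCubP_anti`, 34c's binder shapes, N05's `B8Eq138LandauZd.isLandau138_zero`, def-R's `suppDomOfRecord`, N07's
`Prop8RegSepTopStep` (HYPOTHESIS).  `--kind proof --supports stmt-QuantumFields-20542 --as helper` (K1⁷; count-neutral).
[15] = [Balaban1985Variational]; [6] = [Balaban1985RegularSpaces]; [III] = [Balaban1988Convergent].

WHY.  FILE P3 delivers the K0 road's (152) token from [6] Proposition 6 ON PRINT'S CLASS (the repaired stub 2′'s member `zdCubP 𝔸 L ρ₀`) at the print datum `propCubeP` — three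
sup letters.  `Node00.TorusCoverGaugeTokens152153` did the families-level wrapper with the fourth letter `|ΔA|` and the (153)-gauge of the lift at the OLD datum `propCube` ∕
full member `zdCub`.  This file is the same swap dag-n07-e named («`propCube ↦ propCubeP`, `zdCub ↦ zdCubP ρ`, floor `(44+3L)L ↦ (44+4ρ)L`»): FILE P3's proof VERBATIM (the empty
cube at `M = 0`, where the (153)-gauge of the lift is the zero potential `isLandau138_zero`; the generic cube letter `M₀ ∈ {M, LM}` at scale `n` with print side `M′ = sideP ≤
M₀ + 44 + 2ρ`; the collar clause from `Sect2.SeqSeparated` ∕ the hull at `n = 1` under the floor `(11·4 + 4ρ)·L ≤ M₁`; print's «7dL²M′α₀ ≤ c₁» and the `2π`-window from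
`ε_{n−1} ≤ a0OfP`; the letters at `2r < b9OfP·ε_n`) with the six-clause one-cube theorem; then the bare `ρ₀ ≥ 1` passage `ρ := ρ₀·L` (`prop6Printed_zdCubP_anti`) and the
(9)–(10) reduction for critical configurations from stub 1's fact `Prop8RegSepTopStep` as HYPOTHESIS (34c's `gauge9R10_of_prop8TopStep_of_gauge152R10` shape).

CONTENTS.  §1 ★★★ `gauge152_153_of_prop6P` · `gauge152_153_of_prop6P_of_one_le`.  §2 ★★ `gauge9_152_153_of_prop8TopStep_of_prop6P` · `gauge9_152_153_of_prop8TopStep_of_prop6P_of_one_le`.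

HONEST FRAMING: compositions by name; [6] Proposition 6 on print's class at the member is the HYPOTHESIS `hP6` (N05's node ∕ stub 2′'s body; never asserted here); stub 1's
`Prop8RegSepTopStep` is the HYPOTHESIS `h8` of §2; (153) stays in MEMBER currency for the `ℤᵈ` LIFT on the print datum's largest cube `□₀` (no torus-native `R`; plan g79's
ruling); the token's unused binders `0 < ν.M₁`, `1 ≤ k`, downward comparability are dropped in §1 (explicit statements, not `def` tokens); nothing of Bałaban discharged;
stub 2′ ∕ N07 ∕ N05 ∕ K0⁷ ∕ K1⁷ NOT closed; counts unmoved (5∕27); one finite T⁴ programme at fixed ε — NOT continuum ∕ ℝ⁴ ∕ infinite volume ∕ OS ∕ mass gap ∕ Clay.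
No `sorry`, no `def`, no `instance`, no `notation`.
-/

noncomputable section

namespace Literature.MathematicalPhysics.QuantumFieldTheory.Balaban1983to89.Node00

open scoped Matrix.Norms.L2Operator
open T4Continuum (T4Family)
open B15DeterminingSets B12RegularSpaces111
open B15Eq112TorusCover (cover)
open B14DomainGeom (Pt)
open B14.Eq213MaximalDomains (side cubeExt)
open B7Prop1Explicit (e)
open B8Eq131Cubes (box tcube bLo bHi)
open B8LeafModelZd (ZdIdx)
open B8Eq138LandauZd (IsLandau138 isLandau138_zero)

variable {F : T4Family} {N : ℕ} [NeZero N]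

/-! ## §1  ★★★ The six clauses on every grid cube of a class member, from [6] Prop. 6 on print's class -/

section Wrapper

/-- ★★★ **[15] (152) WITH ALL FOUR LETTERS AND (153) FOR THE LIFT, ON EVERY GRID CUBE OF A CLASS MEMBER ⟸ [6] PROP. 6 ON PRINT'S CUBE CLASS AT THE MEMBER** (every cube letter
`M`, every print big block `ρ ≥ L`) — FILE P3's `gauge152R10P_of_prop6` binder block (a separated index `s` with the floor `(11·4 + 4ρ)·L ≤ ν.M₁`; level radii `0 < ε_m ≤
a0OfP F N M ρ B₁ c₁` with `ε_m ≤ 2ε_{m+1}`; `U` in the (1.7)∕(1.9)-Top class over `suppDomOfRecord`; a scale `1 ≤ n ≤ k`; the cube letter `M₀ ∈ {M, L·M}` — the two families, the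
second written at scale `n`; a non-wrapping grid cube `□ = cubeEnl (F.P K) (LⁿM₀) a 0 ⊆ Ω_n`), CONCLUSION: an `SU(N)` gauge `u` and a potential `A` on `□` with `(ι∘U)^{ι∘u} =
e^{iη_nA}`, `‖A‖ < b9OfP·ε_n` on the bonds, `‖∇^{η_n}A‖ < b9OfP·ε_n` on the stencils, `‖∂^{η_n*}∂^{η_n}A‖ < b9OfP·ε_n` AND `‖Δ^{η_n}A‖ < b9OfP·ε_n` (r11's `grad` letters, inline) on
the deep bonds — [15] (152)'s four members — AND a `ℤᵈ` potential `A′` with `A ⟨π x, μ⟩ = A′ x μ` on the lifted cube, in the (153)-gauge `IsLandau138 L c.k η_n (c.sq 0) c.lamS 1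
A′` of the PRINT datum `c = propCubeP (F.P K) n hn M₀ ρ hρ a`.  Prop. 6 on print's class is the HYPOTHESIS `hP6`.
[cite: Balaban1985Variational, (144)–(153) pp.300–301, Thm 1 (10) p.279; Balaban1985RegularSpaces, Prop. 6 (1.135)–(1.138) p.99, p.98; Balaban1988Convergent, (2.13) p.256, p.255] -/
theorem gauge152_153_of_prop6P {B₁ c₁ : ℝ} (hB₁ : 0 ≤ B₁) (hc₁ : 0 < c₁) {ρ : ℕ}
    (hP6 : letI : CStarAlgebra (MatA N) := {}; B8.Prop6Printed 4 (F.L : ℝ) B₁ c₁ (fun i : ZdIdx 4 F.L => zdCubP (MatA N) F.L ρ i)) (M : ℕ)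
    (ν : Stage7Numerics) (g : ℕ → ℝ) (K k : ℕ) (hρ : (F.P K).L ≤ ρ) (s : SeqOfRecord F ν M g K k) (hsep : Sect2.SeqSeparated ν.M₁ s)
    (hfloor : (11 * 4 + 4 * ρ) * F.L ≤ ν.M₁) (ε : ℕ → ℝ)
    (hε : ∀ m, m ≤ k → 0 < ε m ∧ ε m ≤ a0OfP F N M ρ B₁ c₁) (hcomp : ∀ m, m < k → ε m ≤ 2 * ε (m + 1))
    (U : GaugeField (F.P K) 0 (SU N))
    (h17 : ∀ m, m ≤ k → PlaqSmallOn (Sect2.omegaPlaqsTop s.Ω (suppDomOfRecord F ν K s.Ω) m) (ε m * (F.P K).eta m ^ 2) U)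
    (h19 : ∀ m, m ≤ k → Sect2.CoDivSmallOn (Sect2.omegaBondsTop s.Ω (suppDomOfRecord F ν K s.Ω) m) (ε m * (F.P K).eta m ^ 3) U)
    {n : ℕ} (hn1 : 1 ≤ n) (hnk : n ≤ k) {M₀ : ℕ} (hM₀ : M₀ = M ∨ M₀ = F.L * M)
    (hSN : ((side (F.P K).L M₀ n : ℕ) : ℤ) < (F.P K).sitesPerDir 0)
    (a : Pt (F.P K).d) (hΩ : cubeEnl (F.P K) (side (F.P K).L M₀ n) a 0 ⊆ s.Ω n) :
    ∃ u : GaugeTransf (F.P K) 0 (SU N), ∃ A : PBond (F.P K) 0 → MatA N,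
      (∀ b ∈ (Sect2.regionOfSet (F.P K) (cubeEnl (F.P K) (side (F.P K).L M₀ n) a 0)).bonds,
          gaugeU (fun x => ιSU N (u x)) (fun b' => ιSU N (U b')) b = expI ((F.P K).eta n) (A b)) ∧
      (∀ b ∈ (Sect2.regionOfSet (F.P K) (cubeEnl (F.P K) (side (F.P K).L M₀ n) a 0)).bonds, ‖A b‖ < b9OfP F M ρ B₁ * ε n) ∧
      (∀ q ∈ (Sect2.regionOfSet (F.P K) (cubeEnl (F.P K) (side (F.P K).L M₀ n) a 0)).dpairs,
          ‖grad ((F.P K).eta n) q.2.1 (fun y => A ⟨y, q.2.2⟩) q.1‖ < b9OfP F M ρ B₁ * ε n) ∧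
      (∀ b ∈ Sect2.bondsDeep (cubeEnl (F.P K) (side (F.P K).L M₀ n) a 0), ‖Sect2.codiffCurlA ((F.P K).eta n) A b.src b.dir‖ < b9OfP F M ρ B₁ * ε n) ∧
      (∀ b ∈ Sect2.bondsDeep (cubeEnl (F.P K) (side (F.P K).L M₀ n) a 0),
          ‖∑ ν' : Fin (F.P K).d, (((F.P K).eta n : ℝ) : ℂ)⁻¹ •
              (grad ((F.P K).eta n) ν' (fun y => A ⟨y, b.dir⟩) (b.src.unshift ν') - grad ((F.P K).eta n) ν' (fun y => A ⟨y, b.dir⟩) b.src)‖ <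
            b9OfP F M ρ B₁ * ε n) ∧
      ∃ A' : B7Prop1Explicit.Site (F.P K).d → Fin (F.P K).d → MatA N,
        (∀ x, x ∈ cubeExt (side (F.P K).L M₀ n) a 0 → ∀ μ, A ⟨cover (F.P K) x, μ⟩ = A' x μ) ∧
        IsLandau138 (F.P K).L (propCubeP (F.P K) n hn1 M₀ ρ hρ a).k ((F.P K).eta n) ((propCubeP (F.P K) n hn1 M₀ ρ hρ a).sq 0)
          (propCubeP (F.P K) n hn1 M₀ ρ hρ a).lamS (1 : B7Prop1Explicit.Site (F.P K).d → Fin (F.P K).d → (MatA N)ˣ) A' := by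
  letI : CStarAlgebra (MatA N) := {}
  have hL2 : 2 ≤ F.L := (F.P 0).hL.2
  have hd : 2 ≤ (F.P K).d := by rw [T4Family.P_d]; norm_num
  set M₂ : ℕ := F.L * M + 44 + 2 * ρ with hM₂
  have ha₀ := a0OfP_pos (F := F) (N := N) M ρ hB₁ hc₁
  have hεn : 0 < ε n := (hε n hnk).1
  -- the case `M = 0`: the cube is empty; the (153)-gauge of the lift is witnessed by the zero potential
  rcases Nat.eq_zero_or_pos M with hM0 | hMpos
  · subst hM0
    have hM₀0 : M₀ = 0 := by rcases hM₀ with h | h <;> simp [h]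
    subst hM₀0
    have hS0 : side (F.P K).L 0 n = 0 := by simp [side]
    have hempty : ∀ y, y ∉ cubeEnl (F.P K) (side (F.P K).L 0 n) a 0 := by
      rw [hS0]
      rintro y ⟨z, hz, -⟩
      have h0 := hz ⟨0, by rw [T4Family.P_d]; norm_num⟩
      simp only [Nat.cast_zero, zero_mul, sub_zero, add_zero] at h0
      omega
    have hempty' : ∀ x, x ∉ cubeExt (side (F.P K).L 0 n) a 0 := by
      rw [hS0]
      intro x hx
      have h0 := hx ⟨0, by rw [T4Family.P_d]; norm_num⟩
      simp only [Nat.cast_zero, zero_mul, sub_zero, add_zero] at h0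
      omega
    exact ⟨fun _ => 1, fun _ => 0, fun b hb => (hempty _ hb.1).elim, fun b hb => (hempty _ hb.1).elim, fun q hq => (hempty _ hq.1).elim,
      fun b hb => (hempty _ hb.1).elim, fun b hb => (hempty _ hb.1).elim, 0, fun x hx => (hempty' x hx).elim, isLandau138_zero _ _ _ _ _ _⟩
  -- `M ≥ 1`: the cube letter `M₀ ∈ {M, LM}` is positive and `M₀ + 44 + 2ρ ≤ M₂`
  have hM₀pos : 1 ≤ M₀ := by
    rcases hM₀ with h | h
    · rw [h]; exact hMpos
    · rw [h]; exact Nat.one_le_iff_ne_zero.2 (Nat.mul_ne_zero (F.P 0).L_pos.ne' hMpos.ne')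
  have hM₀' : M₀ + 44 + 2 * ρ ≤ M₂ := by
    rcases hM₀ with h | h
    · rw [h, hM₂]; nlinarith [(F.P 0).L_pos]
    · rw [h, hM₂]
  have hεn1 : 0 < ε (n - 1) := (hε (n - 1) (by omega)).1
  have hεn1a : ε (n - 1) ≤ a0OfP F N M ρ B₁ c₁ := (hε (n - 1) (by omega)).2
  have hε2 : ε (n - 1) ≤ 2 * ε n := by
    have := hcomp (n - 1) (by omega)
    rwa [show n - 1 + 1 = n by omega] at this
  -- the print side `M′ = sideP ≤ M₀ + 44 + 2ρ ≤ M₂`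
  have hside : sideP (F.P K) M₀ ρ ≤ M₂ := by
    have := sideP_le (P := F.P K) M₀ ρ
    rw [T4Family.P_d] at this
    omega
  have hM'r : ((sideP (F.P K) M₀ ρ : ℕ) : ℝ) ≤ (M₂ : ℝ) := by exact_mod_cast hside
  have hM'pos : (0 : ℝ) < ((sideP (F.P K) M₀ ρ : ℕ) : ℝ) := by
    have := le_sideP (P := F.P K) M₀ (lt_of_lt_of_le (F.P K).L_pos hρ)
    exact_mod_cast (show 0 < sideP (F.P K) M₀ ρ by omega)
  have hM₂pos : (0 : ℝ) < M₂ := lt_of_lt_of_le hM'pos hM'r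
  -- the collar clause
  have hcollar : cover (F.P K) '' (cubeIdxP' (F.P K) n hn1 M₀ ρ a).Ω 0 ⊆
      (if n - 1 = 0 then suppDomOfRecord F ν K s.Ω else s.Ω (n - 1)) := by
    rcases Nat.eq_or_lt_of_le hn1 with h1 | h1
    · subst h1
      rw [if_pos rfl, suppDomOfRecord_eq]
      exact cover_image_Ω_cubeIdxP'_one_subset_hullD hρ (by rw [T4Family.P_d, T4Family.P_L]; exact hfloor) hM₀pos a hΩ 0
    · rw [if_neg (by omega)]
      refine cover_image_Ω_cubeIdxP'_subset s hsep hρ ?_ h1 hnk hM₀pos a hΩ 0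
      rw [T4Family.P_d]
      exact le_trans (Nat.le_mul_of_pos_right _ (F.P 0).L_pos) hfloor
  -- the smallness «7dL²M′α₀ ≤ c₁»
  have ha₀c : a0OfP F N M ρ B₁ c₁ ≤ c₁ / (56 * (F.L : ℝ) ^ 5 * M₂) := by rw [hM₂]; exact min_le_left _ _
  have ha₀w : a0OfP F N M ρ B₁ c₁ ≤ 1 / (8 * (M₂ : ℝ) * N * (28 * (F.L : ℝ) ^ 5 * B₁ * M₂) + 1) := by rw [hM₂]; exact min_le_right _ _
  have hc₁' : 7 * (F.P K).d * ((F.P K).L : ℝ) ^ 2 * (propCubeP (F.P K) n hn1 M₀ ρ hρ a).M * (((F.P K).L : ℝ) ^ 3 * ε (n - 1)) ≤ c₁ := by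
    rw [propCubeP_M, T4Family.P_d, T4Family.P_L]
    have h1 : 7 * (4 : ℕ) * (F.L : ℝ) ^ 2 * ((sideP (F.P K) M₀ ρ : ℕ) : ℝ) * ((F.L : ℝ) ^ 3 * ε (n - 1)) ≤ 28 * (F.L : ℝ) ^ 5 * M₂ * a0OfP F N M ρ B₁ c₁ := by
      have : 7 * (4 : ℕ) * (F.L : ℝ) ^ 2 * ((sideP (F.P K) M₀ ρ : ℕ) : ℝ) * ((F.L : ℝ) ^ 3 * ε (n - 1)) =
          28 * (F.L : ℝ) ^ 5 * ((sideP (F.P K) M₀ ρ : ℕ) : ℝ) * ε (n - 1) := by push_cast; ring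
      rw [this]; gcongr
    have h2 : 28 * (F.L : ℝ) ^ 5 * M₂ * a0OfP F N M ρ B₁ c₁ ≤ 28 * (F.L : ℝ) ^ 5 * M₂ * (c₁ / (56 * (F.L : ℝ) ^ 5 * M₂)) :=
      mul_le_mul_of_nonneg_left ha₀c (by positivity)
    have h3 : 28 * (F.L : ℝ) ^ 5 * M₂ * (c₁ / (56 * (F.L : ℝ) ^ 5 * M₂)) = c₁ / 2 := by field_simp; ring
    linarith
  -- the `2π`-window of the normalisation
  have h2π : (2 * boxWidth (bLo (F.P K).L (propCubeP (F.P K) n hn1 M₀ ρ hρ a).a (propCubeP (F.P K) n hn1 M₀ ρ hρ a).k 0)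
      (bHi (F.P K).L (propCubeP (F.P K) n hn1 M₀ ρ hρ a).a (propCubeP (F.P K) n hn1 M₀ ρ hρ a).M (propCubeP (F.P K) n hn1 M₀ ρ hρ a).k 0) + 1) *
      ((F.P K).eta n * N * (7 * (F.P K).d * ((F.P K).L : ℝ) ^ 2 * B₁ * (propCubeP (F.P K) n hn1 M₀ ρ hρ a).M * (((F.P K).L : ℝ) ^ 3 * ε (n - 1)) *
        (((F.P K).L : ℝ) ^ (propCubeP (F.P K) n hn1 M₀ ρ hρ a).k * (F.P K).eta n)⁻¹)) < 2 * Real.pi := by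
    rw [boxWidth_propCubeP, propCubeP_M, propCubeP_k, B12Eq115BackgroundPair.pow_mul_eta, inv_one, mul_one, T4Family.P_d, T4Family.P_L]
    have hη : (F.L : ℝ) ^ n * (F.P K).eta n = 1 := by have := B12Eq115BackgroundPair.pow_mul_eta (F.P K) n; rwa [T4Family.P_L] at this
    have hηpos : 0 < (F.P K).eta n := B3GkZeroTorusRescaled.eta_pos (F.P K) n
    have hW : (2 * ((4 : ℕ) * ((F.L : ℝ) ^ n * ((sideP (F.P K) M₀ ρ : ℕ) : ℝ) - 1)) + 1) * (F.P K).eta n ≤ 8 * ((sideP (F.P K) M₀ ρ : ℕ) : ℝ) := by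
      have : (2 * ((4 : ℕ) * ((F.L : ℝ) ^ n * ((sideP (F.P K) M₀ ρ : ℕ) : ℝ) - 1)) + 1) * (F.P K).eta n =
          8 * ((sideP (F.P K) M₀ ρ : ℕ) : ℝ) * ((F.L : ℝ) ^ n * (F.P K).eta n) - 7 * (F.P K).eta n := by push_cast; ring
      rw [this, hη, mul_one]; linarith
    have hr : 7 * (4 : ℕ) * (F.L : ℝ) ^ 2 * B₁ * ((sideP (F.P K) M₀ ρ : ℕ) : ℝ) * ((F.L : ℝ) ^ 3 * ε (n - 1)) ≤ 28 * (F.L : ℝ) ^ 5 * B₁ * M₂ * a0OfP F N M ρ B₁ c₁ := by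
      have : 7 * (4 : ℕ) * (F.L : ℝ) ^ 2 * B₁ * ((sideP (F.P K) M₀ ρ : ℕ) : ℝ) * ((F.L : ℝ) ^ 3 * ε (n - 1)) =
          28 * (F.L : ℝ) ^ 5 * B₁ * ((sideP (F.P K) M₀ ρ : ℕ) : ℝ) * ε (n - 1) := by push_cast; ring
      rw [this]; gcongr
    set X : ℝ := 8 * (M₂ : ℝ) * N * (28 * (F.L : ℝ) ^ 5 * B₁ * M₂) with hX
    have hX0 : 0 ≤ X := by positivity
    have hXa : X * a0OfP F N M ρ B₁ c₁ < 1 := by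
      calc X * a0OfP F N M ρ B₁ c₁ ≤ X * (1 / (X + 1)) := mul_le_mul_of_nonneg_left ha₀w hX0
        _ < 1 := by rw [mul_one_div, div_lt_one (by positivity)]; linarith
    have hNr : (0 : ℝ) ≤ N := Nat.cast_nonneg N
    calc (2 * ((4 : ℕ) * ((F.L : ℝ) ^ n * ((sideP (F.P K) M₀ ρ : ℕ) : ℝ) - 1)) + 1) *
          ((F.P K).eta n * N * (7 * (4 : ℕ) * (F.L : ℝ) ^ 2 * B₁ * ((sideP (F.P K) M₀ ρ : ℕ) : ℝ) * ((F.L : ℝ) ^ 3 * ε (n - 1))))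
        = ((2 * ((4 : ℕ) * ((F.L : ℝ) ^ n * ((sideP (F.P K) M₀ ρ : ℕ) : ℝ) - 1)) + 1) * (F.P K).eta n) *
          (N * (7 * (4 : ℕ) * (F.L : ℝ) ^ 2 * B₁ * ((sideP (F.P K) M₀ ρ : ℕ) : ℝ) * ((F.L : ℝ) ^ 3 * ε (n - 1)))) := by ring
      _ ≤ (8 * ((sideP (F.P K) M₀ ρ : ℕ) : ℝ)) * (N * (28 * (F.L : ℝ) ^ 5 * B₁ * M₂ * a0OfP F N M ρ B₁ c₁)) := by
          gcongr
      _ ≤ (8 * (M₂ : ℝ)) * (N * (28 * (F.L : ℝ) ^ 5 * B₁ * M₂ * a0OfP F N M ρ B₁ c₁)) := by gcongr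
      _ = X * a0OfP F N M ρ B₁ c₁ := by rw [hX]; ring
      _ < 1 := hXa
      _ < 2 * Real.pi := by linarith [Real.pi_gt_three]
  obtain ⟨u, A, h1, h2, h3, h4, h4', A', hA', h5⟩ :=
    exists_localGauge152_153_cube_of_prop6P (P := F.P K) hd hB₁ (dvd_refl ρ) hρ hP6 U h17 h19 hn1 (by omega) hεn1 a hSN hcollar hc₁' h2π
  -- the letters at `b9OfP·ε_n`
  have hbound : 2 * (7 * (F.P K).d * ((F.P K).L : ℝ) ^ 2 * B₁ * (propCubeP (F.P K) n hn1 M₀ ρ hρ a).M * (((F.P K).L : ℝ) ^ 3 * ε (n - 1))) <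
      b9OfP F M ρ B₁ * ε n := by
    rw [propCubeP_M, T4Family.P_d, T4Family.P_L, b9OfP]
    have : 2 * (7 * (4 : ℕ) * (F.L : ℝ) ^ 2 * B₁ * ((sideP (F.P K) M₀ ρ : ℕ) : ℝ) * ((F.L : ℝ) ^ 3 * ε (n - 1))) =
        56 * (F.L : ℝ) ^ 5 * B₁ * ((sideP (F.P K) M₀ ρ : ℕ) : ℝ) * ε (n - 1) := by push_cast; ring
    rw [this]
    calc 56 * (F.L : ℝ) ^ 5 * B₁ * ((sideP (F.P K) M₀ ρ : ℕ) : ℝ) * ε (n - 1) ≤ 56 * (F.L : ℝ) ^ 5 * B₁ * M₂ * (2 * ε n) := by gcongr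
      _ = (112 * (F.L : ℝ) ^ 5 * B₁ * M₂) * ε n := by ring
      _ < (112 * (F.L : ℝ) ^ 5 * B₁ * ((F.L * M + 44 + 2 * ρ : ℕ) : ℝ) + 1) * ε n := by
          rw [hM₂]; exact mul_lt_mul_of_pos_right (lt_add_one _) hεn
  exact ⟨u, A, h1, fun b hb => (h2 b hb).trans_lt hbound, fun q hq => (h3 q hq).trans_lt hbound, fun b hb => (h4 b hb).trans_lt hbound,
    fun b hb => (h4' b hb).trans_lt hbound, A', hA', h5⟩

/-- ★ **THE SAME AT STUB 2′'s BARE `ρ₀ ≥ 1`** (`ρ := ρ₀·L ≥ L`, by `prop6Printed_zdCubP_anti`; floor `(11·4 + 4·(ρ₀L))·L`, constants `b9OfP F M (ρ₀L) B₁`, `a0OfP F N M (ρ₀L) B₁ c₁`).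
[cite: Balaban1985Variational, (144)–(153) pp.300–301; Balaban1985RegularSpaces, Prop. 6 p.99, p.98 («M is a multiple of R₁M₁»)] -/
theorem gauge152_153_of_prop6P_of_one_le {B₁ c₁ : ℝ} (hB₁ : 0 ≤ B₁) (hc₁ : 0 < c₁) {ρ₀ : ℕ} (hρ₀ : 1 ≤ ρ₀)
    (hP6 : letI : CStarAlgebra (MatA N) := {}; B8.Prop6Printed 4 (F.L : ℝ) B₁ c₁ (fun i : ZdIdx 4 F.L => zdCubP (MatA N) F.L ρ₀ i)) (M : ℕ)
    (ν : Stage7Numerics) (g : ℕ → ℝ) (K k : ℕ) (s : SeqOfRecord F ν M g K k) (hsep : Sect2.SeqSeparated ν.M₁ s)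
    (hfloor : (11 * 4 + 4 * (ρ₀ * F.L)) * F.L ≤ ν.M₁) (ε : ℕ → ℝ)
    (hε : ∀ m, m ≤ k → 0 < ε m ∧ ε m ≤ a0OfP F N M (ρ₀ * F.L) B₁ c₁) (hcomp : ∀ m, m < k → ε m ≤ 2 * ε (m + 1))
    (U : GaugeField (F.P K) 0 (SU N))
    (h17 : ∀ m, m ≤ k → PlaqSmallOn (Sect2.omegaPlaqsTop s.Ω (suppDomOfRecord F ν K s.Ω) m) (ε m * (F.P K).eta m ^ 2) U)
    (h19 : ∀ m, m ≤ k → Sect2.CoDivSmallOn (Sect2.omegaBondsTop s.Ω (suppDomOfRecord F ν K s.Ω) m) (ε m * (F.P K).eta m ^ 3) U)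
    {n : ℕ} (hn1 : 1 ≤ n) (hnk : n ≤ k) {M₀ : ℕ} (hM₀ : M₀ = M ∨ M₀ = F.L * M)
    (hSN : ((side (F.P K).L M₀ n : ℕ) : ℤ) < (F.P K).sitesPerDir 0)
    (a : Pt (F.P K).d) (hΩ : cubeEnl (F.P K) (side (F.P K).L M₀ n) a 0 ⊆ s.Ω n) :
    ∃ u : GaugeTransf (F.P K) 0 (SU N), ∃ A : PBond (F.P K) 0 → MatA N,
      (∀ b ∈ (Sect2.regionOfSet (F.P K) (cubeEnl (F.P K) (side (F.P K).L M₀ n) a 0)).bonds,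
          gaugeU (fun x => ιSU N (u x)) (fun b' => ιSU N (U b')) b = expI ((F.P K).eta n) (A b)) ∧
      (∀ b ∈ (Sect2.regionOfSet (F.P K) (cubeEnl (F.P K) (side (F.P K).L M₀ n) a 0)).bonds, ‖A b‖ < b9OfP F M (ρ₀ * F.L) B₁ * ε n) ∧
      (∀ q ∈ (Sect2.regionOfSet (F.P K) (cubeEnl (F.P K) (side (F.P K).L M₀ n) a 0)).dpairs,
          ‖grad ((F.P K).eta n) q.2.1 (fun y => A ⟨y, q.2.2⟩) q.1‖ < b9OfP F M (ρ₀ * F.L) B₁ * ε n) ∧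
      (∀ b ∈ Sect2.bondsDeep (cubeEnl (F.P K) (side (F.P K).L M₀ n) a 0),
          ‖Sect2.codiffCurlA ((F.P K).eta n) A b.src b.dir‖ < b9OfP F M (ρ₀ * F.L) B₁ * ε n) ∧
      (∀ b ∈ Sect2.bondsDeep (cubeEnl (F.P K) (side (F.P K).L M₀ n) a 0),
          ‖∑ ν' : Fin (F.P K).d, (((F.P K).eta n : ℝ) : ℂ)⁻¹ •
              (grad ((F.P K).eta n) ν' (fun y => A ⟨y, b.dir⟩) (b.src.unshift ν') - grad ((F.P K).eta n) ν' (fun y => A ⟨y, b.dir⟩) b.src)‖ <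
            b9OfP F M (ρ₀ * F.L) B₁ * ε n) ∧
      ∃ A' : B7Prop1Explicit.Site (F.P K).d → Fin (F.P K).d → MatA N,
        (∀ x, x ∈ cubeExt (side (F.P K).L M₀ n) a 0 → ∀ μ, A ⟨cover (F.P K) x, μ⟩ = A' x μ) ∧
        IsLandau138 (F.P K).L (propCubeP (F.P K) n hn1 M₀ (ρ₀ * F.L) (Nat.le_mul_of_pos_left F.L hρ₀) a).k ((F.P K).eta n)
          ((propCubeP (F.P K) n hn1 M₀ (ρ₀ * F.L) (Nat.le_mul_of_pos_left F.L hρ₀) a).sq 0)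
          (propCubeP (F.P K) n hn1 M₀ (ρ₀ * F.L) (Nat.le_mul_of_pos_left F.L hρ₀) a).lamS
          (1 : B7Prop1Explicit.Site (F.P K).d → Fin (F.P K).d → (MatA N)ˣ) A' := by
  letI : CStarAlgebra (MatA N) := {}
  exact gauge152_153_of_prop6P hB₁ hc₁ (prop6Printed_zdCubP_anti (fun i : ZdIdx 4 F.L => i) (Dvd.intro F.L rfl) hP6) M ν g K k
    (Nat.le_mul_of_pos_left F.L hρ₀) s hsep hfloor ε hε hcomp U h17 h19 hn1 hnk hM₀ hSN a hΩ

end Wrapper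

/-! ## §2  ★★ The (9)–(10) compositions for critical configurations: stub 1's fact ∧ Prop. 6 on print's class -/

section NineStep

/-- ★★ **[15] THM 1 (9) line 1 AND (10) — BOTH MEMBERS — WITH THE (153)-GAUGE OF (9)'s `u` FOR THE LIFT, FOR CRITICAL CONFIGURATIONS ⟸ [15] PROP. 8's TOP STEP ∧ [6] PROP. 6
ON PRINT'S CLASS** — 34c's `gauge9R10_of_prop8TopStep_of_gauge152R10` shape re-run through `gauge152_153_of_prop6P` at the radii `B₃δ_•` of (8): for a CRITICAL `U` on the fibre
of a (7)-datum `W` in the (1.7)∕(1.9)-Top class at `ε₀` (binder block of 34c's `Gauge9RegSepTopStepR10` with the floor `(11·4 + 4ρ)·L ≤ ν.M₁`; `0 < B₃`, `B₃a₁ ≤ a0OfP`), on every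
non-wrapping grid cube of the two families the six clauses at `b9OfP·B₃·δ_n` — [15] (9) (no Hölder member) + (10) (both members) + (153) for the lift at the print datum.  Stub 1's
`Prop8RegSepTopStep` is the HYPOTHESIS `h8`, Prop. 6 on print's class the HYPOTHESIS `hP6`.
[cite: Balaban1985Variational, Thm 1 (8)–(10) p.279, Sect. F pp.300–305, Prop. 8 p.304, (152)–(153) p.301; Balaban1985RegularSpaces, Prop. 6 p.99] -/
theorem gauge9_152_153_of_prop8TopStep_of_prop6P {B₁ c₁ B₃ a₀ a₁ : ℝ} (hB₁ : 0 ≤ B₁) (hc₁ : 0 < c₁) {ρ : ℕ}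
    (hP6 : letI : CStarAlgebra (MatA N) := {}; B8.Prop6Printed 4 (F.L : ℝ) B₁ c₁ (fun i : ZdIdx 4 F.L => zdCubP (MatA N) F.L ρ i)) (M : ℕ)
    (h8 : Prop8RegSepTopStep F N (fun ν K Ω => suppDomOfRecord F ν K Ω) B₃ a₀ a₁) (hB₃ : 0 < B₃) (ha : B₃ * a₁ ≤ a0OfP F N M ρ B₁ c₁)
    (ν : Stage7Numerics) (g : ℕ → ℝ) (K k : ℕ) (hρ : (F.P K).L ≤ ρ) (s : SeqOfRecord F ν M g K k) (hsep : Sect2.SeqSeparated ν.M₁ s) (hM₁ : 0 < ν.M₁)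
    (hfloor : (11 * 4 + 4 * ρ) * F.L ≤ ν.M₁) (hk : 1 ≤ k) (ε₀ : ℝ) (δ : ℕ → ℝ)
    (hδ : ∀ m, m ≤ k → 0 < δ m ∧ δ m ≤ a₁ ∧ B₃ * δ m ≤ ε₀) (hcomp : ∀ m, m < k → δ m ≤ 2 * δ (m + 1)) (hcomp' : ∀ m, m < k → δ (m + 1) ≤ 2 * δ m)
    (hε₀ : ε₀ ≤ a₀) (W : MSField (F.P K) (SU N)) (h7 : Sect2.DataSmall7PTop (avOfRecord F N K) s.Ω (suppDomOfRecord F ν K s.Ω) k δ W)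
    (U : GaugeField (F.P K) 0 (SU N))
    (h17 : ∀ m, m ≤ k → PlaqSmallOn (Sect2.omegaPlaqsTop s.Ω (suppDomOfRecord F ν K s.Ω) m) (ε₀ * (F.P K).eta m ^ 2) U)
    (h19 : Sect2.CoDivClassOnTop s.Ω (suppDomOfRecord F ν K s.Ω) k ε₀ U) (hfib : AgreeOn (genSet s.Ω k) (avgFamily (avOfRecord F N K) U) W)
    (hcrit : IsCritOnFibre F N K (genSet s.Ω k) W U)
    {n : ℕ} (hn1 : 1 ≤ n) (hnk : n ≤ k) {M₀ : ℕ} (hM₀ : M₀ = M ∨ M₀ = F.L * M)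
    (hSN : ((side (F.P K).L M₀ n : ℕ) : ℤ) < (F.P K).sitesPerDir 0)
    (a : Pt (F.P K).d) (hΩ : cubeEnl (F.P K) (side (F.P K).L M₀ n) a 0 ⊆ s.Ω n) :
    ∃ u : GaugeTransf (F.P K) 0 (SU N), ∃ A : PBond (F.P K) 0 → MatA N,
      (∀ b ∈ (Sect2.regionOfSet (F.P K) (cubeEnl (F.P K) (side (F.P K).L M₀ n) a 0)).bonds,
          gaugeU (fun x => ιSU N (u x)) (fun b' => ιSU N (U b')) b = expI ((F.P K).eta n) (A b)) ∧
      (∀ b ∈ (Sect2.regionOfSet (F.P K) (cubeEnl (F.P K) (side (F.P K).L M₀ n) a 0)).bonds, ‖A b‖ < b9OfP F M ρ B₁ * B₃ * δ n) ∧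
      (∀ q ∈ (Sect2.regionOfSet (F.P K) (cubeEnl (F.P K) (side (F.P K).L M₀ n) a 0)).dpairs,
          ‖grad ((F.P K).eta n) q.2.1 (fun y => A ⟨y, q.2.2⟩) q.1‖ < b9OfP F M ρ B₁ * B₃ * δ n) ∧
      (∀ b ∈ Sect2.bondsDeep (cubeEnl (F.P K) (side (F.P K).L M₀ n) a 0), ‖Sect2.codiffCurlA ((F.P K).eta n) A b.src b.dir‖ < b9OfP F M ρ B₁ * B₃ * δ n) ∧
      (∀ b ∈ Sect2.bondsDeep (cubeEnl (F.P K) (side (F.P K).L M₀ n) a 0),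
          ‖∑ ν' : Fin (F.P K).d, (((F.P K).eta n : ℝ) : ℂ)⁻¹ •
              (grad ((F.P K).eta n) ν' (fun y => A ⟨y, b.dir⟩) (b.src.unshift ν') - grad ((F.P K).eta n) ν' (fun y => A ⟨y, b.dir⟩) b.src)‖ <
            b9OfP F M ρ B₁ * B₃ * δ n) ∧
      ∃ A' : B7Prop1Explicit.Site (F.P K).d → Fin (F.P K).d → MatA N,
        (∀ x, x ∈ cubeExt (side (F.P K).L M₀ n) a 0 → ∀ μ, A ⟨cover (F.P K) x, μ⟩ = A' x μ) ∧
        IsLandau138 (F.P K).L (propCubeP (F.P K) n hn1 M₀ ρ hρ a).k ((F.P K).eta n) ((propCubeP (F.P K) n hn1 M₀ ρ hρ a).sq 0)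
          (propCubeP (F.P K) n hn1 M₀ ρ hρ a).lamS (1 : B7Prop1Explicit.Site (F.P K).d → Fin (F.P K).d → (MatA N)ˣ) A' := by
  obtain ⟨h8p, h8c⟩ := h8 ν M g K k s hsep hM₁ hk ε₀ δ hδ hcomp hcomp' hε₀ W h7 U h17 h19 hfib hcrit
  have hε : ∀ m, m ≤ k → 0 < B₃ * δ m ∧ B₃ * δ m ≤ a0OfP F N M ρ B₁ c₁ := fun m hm =>
    ⟨mul_pos hB₃ (hδ m hm).1, (mul_le_mul_of_nonneg_left (hδ m hm).2.1 hB₃.le).trans ha⟩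
  have hc1 : ∀ m, m < k → B₃ * δ m ≤ 2 * (B₃ * δ (m + 1)) := fun m hm => by
    have := mul_le_mul_of_nonneg_left (hcomp m hm) hB₃.le; linarith
  have h := gauge152_153_of_prop6P hB₁ hc₁ hP6 M ν g K k hρ s hsep hfloor (fun m => B₃ * δ m) hε hc1 U h8p h8c hn1 hnk hM₀ hSN a hΩ
  rw [show b9OfP F M ρ B₁ * B₃ * δ n = b9OfP F M ρ B₁ * (B₃ * δ n) by ring]
  exact h

end NineStep

end Literature.MathematicalPhysics.QuantumFieldTheory.Balaban1983to89.Node00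

end
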